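import Literature.Computability.AlgebraicComplexity.RealTauKnownCases

/-!
# `MatrixDescartes` census — F1: FULL ALTERNATION of a Descartes-sharp polynomial (kernel version)

HONEST FRAMING.  Object-search cell `pub-symmetroid`, route crux `Theses.LacunarySymmetroid.MatrixDescartes`
(ledger item stmt-ValiantsHypothesis-18050).  This is fact F1 of the cell's sign-level support certificates
(STRUCTURE.md C22 «sign-class / parity–Minkowski», LAYER1-SIGNCLASS-lead.md; also the «forced letters» row L3 of
the LP certificates T-NC-LP-CERT / LP34), as a kernel theorem about an arbitrary real polynomial `f`:

* `coeff_mul_coeff_neg_of_signVariations` / `coeff_mul_coeff_neg_of_sharp` — if `Var(f) + 1 = #supp f`, in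
  particular if `f` has at least `#supp f − 1` distinct positive roots (Descartes: `#Z₊ ≤ Var < #supp`,
  `card_posRoots_le_signVariations` + the tree's `signVariations_lt_card_support`), then CONSECUTIVE support
  coefficients have opposite signs;
* `pow_neg_one_mul_coeff_mul_coeff_pos_of_sharp`, `pow_rank_mul_coeff_mul_coeff_pos_of_sharp` — the same in
  rank form: `sign (coeff f e) = s · (−1)^{rank e}` for one global sign `s`, `rank e = #{y ∈ supp f : y < e}`,
  written as `0 < (−1)^{rank a + rank b} · coeff a · coeff b`.

Proof: induction along `Polynomial.eraseLead` with Mathlib's `signVariations_eq_eraseLead_add_ite` (dropping the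
leading term loses exactly one variation when the count is maximal, and that variation sits between the two top
support coefficients).  What is NOT here: the parity half of Descartes' rule (not needed), the letter dictionary at
`m = 2` and the 2-colourability test (companion file `…CensusSignClass.lean`), anything about the crux
`MatrixDescartes` or `VP ≠ VNP`.

[folklore] Descartes' rule of signs (Mathlib `Polynomial.roots_countP_pos_le_signVariations`); elementary.
-/

-- `Summit.ValiantsHypothesis.ValiantsHypothesis.…` repeats a component by the D-0017 layout
-- (single-conjunct summit), which the `dupNamespace` linter flags; the name is mandated.
set_option linter.dupNamespace false

namespace Summit.ValiantsHypothesis.ValiantsHypothesis.Theorems.LacunarySymmetroidMatrixDescartes.Census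

open Polynomial Finset
open scoped BigOperators Polynomial

/-- Distinct positive roots are at most Descartes' sign-variation count:
`#Z₊(f) ≤ Var(f)` (Mathlib's `roots_countP_pos_le_signVariations` counts with multiplicity). [folklore] -/
theorem card_posRoots_le_signVariations (f : ℝ[X]) :
    (f.roots.toFinset.filter (fun x => 0 < x)).card ≤ f.signVariations := by
  calc (f.roots.toFinset.filter (fun x => 0 < x)).card
      = (f.roots.filter (fun x => 0 < x)).toFinset.card := by rw [Multiset.toFinset_filter]
    _ ≤ (f.roots.filter (fun x => 0 < x)).card := Multiset.toFinset_card_le _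
    _ = f.roots.countP (fun x => 0 < x) := (Multiset.countP_eq_card_filter _ _).symm
    _ ≤ f.signVariations := f.roots_countP_pos_le_signVariations

/-- Two non-zero reals with opposite `SignType.sign` have negative product. [folklore] -/
theorem mul_neg_of_sign_eq_neg_sign {x y : ℝ} (hx : x ≠ 0)
    (h : SignType.sign x = -SignType.sign y) : y * x < 0 := by
  rcases lt_or_gt_of_ne hx with hx' | hx'
  · have hy : SignType.sign y = 1 := by
      have := sign_eq_neg_one_iff.mpr hx'; rw [this] at h
      cases hs : SignType.sign y <;> rw [hs] at h <;> simp_all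
    exact mul_neg_of_pos_of_neg (sign_eq_one_iff.mp hy) hx'
  · have hy : SignType.sign y = -1 := by
      have := sign_eq_one_iff.mpr hx'; rw [this] at h
      cases hs : SignType.sign y <;> rw [hs] at h <;> simp_all
    exact mul_neg_of_neg_of_pos (sign_eq_neg_one_iff.mp hy) hx'

/-- **F1 — full alternation (consecutive form).**  If a real polynomial has the maximal number of
sign variations its support allows, `Var(f) + 1 = #supp f`, then any two CONSECUTIVE support exponents
`a < b` (no support element strictly between) carry coefficients of opposite signs. [folklore] -/
theorem coeff_mul_coeff_neg_of_signVariations :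
    ∀ (k : ℕ) (f : ℝ[X]), f.support.card = k → f.signVariations + 1 = k →
      ∀ a ∈ f.support, ∀ b ∈ f.support, a < b → (∀ c ∈ f.support, ¬ (a < c ∧ c < b)) →
        f.coeff a * f.coeff b < 0 := by
  intro k
  induction k with
  | zero =>
    intro f hk _ a ha
    rw [Finset.card_eq_zero] at hk
    simp [hk] at ha
  | succ k ih =>
    intro f hk hV a ha b hb hab hcons
    have hf : f ≠ 0 := by rintro rfl; simp at ha
    have hgcard : f.eraseLead.support.card = k := by
      have := card_support_eraseLead_add_one hf; omega
    have hite := signVariations_eq_eraseLead_add_ite hf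
    by_cases hg : f.eraseLead = 0
    · -- then `#supp f = 1`: no two distinct support elements
      exfalso
      have h1 := card_support_le_one_of_eraseLead_eq_zero hg
      rw [Finset.card_le_one] at h1
      exact hab.ne (h1 a ha b hb)
    have hVg : f.eraseLead.signVariations < k :=
      hgcard ▸ Literature.Computability.AlgebraicComplexity.signVariations_lt_card_support hg
    have hVg' : f.eraseLead.signVariations + 1 = k := by split_ifs at hite <;> omega
    have hsign : SignType.sign f.leadingCoeff = -SignType.sign f.eraseLead.leadingCoeff := by
      by_contra h; rw [if_neg h] at hite; omega
    have h2 : 2 ≤ f.support.card := by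
      by_contra h
      have : f.support.card ≤ 1 := by omega
      rw [Finset.card_le_one] at this
      exact hab.ne (this a ha b hb)
    have hlt : f.eraseLead.natDegree < f.natDegree := eraseLead_natDegree_lt h2
    rcases eq_or_ne b f.natDegree with rfl | hbne
    · -- the top pair: `a` is the degree of `eraseLead f`
      have ha' : a ∈ f.eraseLead.support := by
        rw [eraseLead_support]; exact Finset.mem_erase.mpr ⟨hab.ne, ha⟩
      have hgs : f.eraseLead.natDegree ∈ f.support :=
        Finset.mem_of_mem_erase (eraseLead_support f ▸ natDegree_mem_support_of_nonzero hg)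
      have hale : a ≤ f.eraseLead.natDegree := le_natDegree_of_mem_supp a ha'
      have haeq : a = f.eraseLead.natDegree := by
        by_contra hne
        exact hcons _ hgs ⟨lt_of_le_of_ne hale hne, hlt⟩
      subst haeq
      have hca : f.coeff f.eraseLead.natDegree = f.eraseLead.leadingCoeff := by
        rw [leadingCoeff, eraseLead_coeff_of_ne _ hlt.ne]
      rw [hca, coeff_natDegree]
      exact mul_neg_of_sign_eq_neg_sign (leadingCoeff_ne_zero.mpr hf) hsign
    · -- both exponents survive in `eraseLead f`
      have hblt : b < f.natDegree := lt_of_le_of_ne (le_natDegree_of_mem_supp b hb) hbne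
      have hb' : b ∈ f.eraseLead.support := by
        rw [eraseLead_support]; exact Finset.mem_erase.mpr ⟨hbne, hb⟩
      have ha' : a ∈ f.eraseLead.support := by
        rw [eraseLead_support]; exact Finset.mem_erase.mpr ⟨(hab.trans hblt).ne, ha⟩
      have key := ih f.eraseLead hgcard hVg' a ha' b hb' hab (fun c hc => hcons c (by
        rw [eraseLead_support] at hc; exact Finset.mem_of_mem_erase hc))
      rwa [eraseLead_coeff_of_ne _ (hab.trans hblt).ne, eraseLead_coeff_of_ne _ hblt.ne] at key

/-- **F1 for a Descartes-sharp polynomial.**  If `f` has at least `#supp f − 1` distinct positive roots, then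
consecutive support coefficients alternate strictly in sign. [folklore] -/
theorem coeff_mul_coeff_neg_of_sharp (f : ℝ[X])
    (hZ : f.support.card ≤ (f.roots.toFinset.filter (fun x => 0 < x)).card + 1)
    {a b : ℕ} (ha : a ∈ f.support) (hb : b ∈ f.support) (hab : a < b)
    (hcons : ∀ c ∈ f.support, ¬ (a < c ∧ c < b)) : f.coeff a * f.coeff b < 0 := by
  have hf : f ≠ 0 := by rintro rfl; simp at ha
  have h1 := card_posRoots_le_signVariations f
  have h2 := Literature.Computability.AlgebraicComplexity.signVariations_lt_card_support hf
  exact coeff_mul_coeff_neg_of_signVariations _ f rfl (by omega) a ha b hb hab hcons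

/-- **F1, rank-parity form.**  For a Descartes-sharp `f`, the sign of the coefficient at a support exponent
`b` is `(−1)^{rank}` times the sign at a smaller support exponent `a`, where `rank` counts the support
elements in `(a, b]`: `0 < (−1)^{#(supp ∩ (a,b])} · coeff a · coeff b`. [folklore] -/
theorem pow_neg_one_mul_coeff_mul_coeff_pos_of_sharp (f : ℝ[X])
    (hZ : f.support.card ≤ (f.roots.toFinset.filter (fun x => 0 < x)).card + 1) :
    ∀ (n : ℕ) {a b : ℕ}, a ∈ f.support → b ∈ f.support → a ≤ b →
      (f.support.filter (fun c => a < c ∧ c ≤ b)).card = n →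
        0 < (-1 : ℝ) ^ n * (f.coeff a * f.coeff b) := by
  intro n
  induction n using Nat.strong_induction_on with
  | _ n ih =>
    intro a b ha hb hab hn
    rcases hab.eq_or_lt with rfl | hlt
    · -- a = b: the filter is empty
      have : n = 0 := by
        rw [← hn, Finset.card_eq_zero, Finset.filter_eq_empty_iff]
        intro c _ h; omega
      subst this
      have hca : f.coeff a ≠ 0 := mem_support_iff.mp ha
      simpa using mul_self_pos.mpr hca
    · -- take the largest support element `c` with `a ≤ c < b`… easier: the predecessor of `b`
      -- let `c` = max of supp ∩ [a, b)
      have hne : (f.support.filter (fun c => a ≤ c ∧ c < b)).Nonempty := ⟨a, by simp [ha, hlt]⟩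
      set c := (f.support.filter (fun c => a ≤ c ∧ c < b)).max' hne with hc
      have hcmem : c ∈ f.support.filter (fun c => a ≤ c ∧ c < b) := Finset.max'_mem _ hne
      simp only [Finset.mem_filter] at hcmem
      obtain ⟨hcs, hac, hcb⟩ := hcmem
      -- `c` and `b` are consecutive
      have hcons : ∀ x ∈ f.support, ¬ (c < x ∧ x < b) := by
        intro x hx ⟨h1, h2⟩
        have : x ≤ c := Finset.le_max' _ x (by simp [hx, h2]; omega)
        omega
      have hstep := coeff_mul_coeff_neg_of_sharp f hZ hcs hb hcb hcons
      -- the count splits: #(a, b] = #(a, c] + 1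
      have hsplit : (f.support.filter (fun x => a < x ∧ x ≤ b)).card
          = (f.support.filter (fun x => a < x ∧ x ≤ c)).card + 1 := by
        have : f.support.filter (fun x => a < x ∧ x ≤ b)
            = insert b (f.support.filter (fun x => a < x ∧ x ≤ c)) := by
          ext x
          simp only [Finset.mem_filter, Finset.mem_insert]
          constructor
          · rintro ⟨hx, h1, h2⟩
            by_cases hxb : x = b
            · exact Or.inl hxb
            · right
              refine ⟨hx, h1, ?_⟩
              by_contra hxc
              exact hcons x hx ⟨by omega, by omega⟩
          · rintro (rfl | ⟨hx, h1, h2⟩)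
            · exact ⟨hb, hlt, le_rfl⟩
            · exact ⟨hx, h1, by omega⟩
        rw [this, Finset.card_insert_of_notMem]
        simp only [Finset.mem_filter, not_and, not_le]
        intro _ _; exact hcb
      set m := (f.support.filter (fun x => a < x ∧ x ≤ c)).card with hm
      have hmn : m < n := by omega
      have hprev := ih m hmn ha hcs hac rfl
      rw [← hn, hsplit, pow_succ]
      -- 0 < (-1)^m * (-1) * (coeff a * coeff b), from hprev and hstep
      have hcc : 0 < f.coeff c * f.coeff c := mul_self_pos.mpr (mem_support_iff.mp hcs)
      nlinarith [hprev, hstep, hcc, sq_nonneg ((-1 : ℝ) ^ m)]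


/-- Counting support elements: for support exponents `a ≤ b`, `#(supp ∩ (a,b]) + rank a = rank b` where
`rank x = #{y ∈ supp : y < x}`. [folklore] -/
theorem card_filter_Ioc_add_rank_eq_rank (s : Finset ℕ) {a b : ℕ} (ha : a ∈ s) (hb : b ∈ s) (hab : a ≤ b) :
    (s.filter (fun c => a < c ∧ c ≤ b)).card + (s.filter (fun c => c < a)).card
      = (s.filter (fun c => c < b)).card := by
  have h1 : s.filter (fun c => c < b) ∪ {b} = (s.filter (fun c => c < a) ∪ {a}) ∪
      s.filter (fun c => a < c ∧ c ≤ b) := by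
    ext x
    simp only [Finset.mem_union, Finset.mem_filter, Finset.mem_singleton]
    constructor
    · rintro (⟨hx, hxb⟩ | rfl)
      · by_cases hxa : x < a
        · exact Or.inl (Or.inl ⟨hx, hxa⟩)
        · by_cases hxa' : x = a
          · exact Or.inl (Or.inr hxa')
          · exact Or.inr ⟨hx, by omega, hxb.le⟩
      · by_cases hba : x = a
        · exact Or.inl (Or.inr hba)
        · exact Or.inr ⟨hb, by omega, le_rfl⟩
    · rintro ((⟨hx, hxa⟩ | rfl) | ⟨hx, hxa, hxb⟩)
      · exact Or.inl ⟨hx, by omega⟩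
      · rcases hab.eq_or_lt with rfl | h
        · exact Or.inr rfl
        · exact Or.inl ⟨ha, h⟩
      · rcases hxb.eq_or_lt with rfl | h
        · exact Or.inr rfl
        · exact Or.inl ⟨hx, h⟩
  have hd1 : Disjoint (s.filter (fun c => c < b)) {b} := by simp
  have hd2 : Disjoint (s.filter (fun c => c < a)) {a} := by simp
  have hd3 : Disjoint (s.filter (fun c => c < a) ∪ {a}) (s.filter (fun c => a < c ∧ c ≤ b)) := by
    rw [Finset.disjoint_left]
    intro x hx
    simp only [Finset.mem_union, Finset.mem_filter, Finset.mem_singleton] at hx ⊢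
    rintro ⟨_, h, _⟩
    rcases hx with ⟨_, h'⟩ | rfl <;> omega
  have := congrArg Finset.card h1
  rw [Finset.card_union_of_disjoint hd1, Finset.card_union_of_disjoint hd3,
    Finset.card_union_of_disjoint hd2, Finset.card_singleton, Finset.card_singleton] at this
  omega

/-- **F1, global rank form** (the form the sign-class certificate C22 uses).  For a Descartes-sharp real
polynomial `f` and ANY two support exponents `a, b`: `0 < (−1)^{rank a + rank b} · coeff a · coeff b`, where
`rank x = #{y ∈ supp f : y < x}` — i.e. `sign (coeff f e) = s · (−1)^{rank e}` for one global sign `s`. [folklore] -/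
theorem pow_rank_mul_coeff_mul_coeff_pos_of_sharp (f : ℝ[X])
    (hZ : f.support.card ≤ (f.roots.toFinset.filter (fun x => 0 < x)).card + 1)
    {a b : ℕ} (ha : a ∈ f.support) (hb : b ∈ f.support) :
    0 < (-1 : ℝ) ^ ((f.support.filter (fun c => c < a)).card + (f.support.filter (fun c => c < b)).card)
      * (f.coeff a * f.coeff b) := by
  wlog hab : a ≤ b generalizing a b
  · have := this hb ha (le_of_not_ge hab)
    rwa [add_comm, mul_comm (f.coeff b)] at this
  have hcount := card_filter_Ioc_add_rank_eq_rank f.support ha hb hab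
  have key := pow_neg_one_mul_coeff_mul_coeff_pos_of_sharp f hZ _ ha hb hab rfl
  have hpow : (-1 : ℝ) ^ ((f.support.filter (fun c => c < a)).card + (f.support.filter (fun c => c < b)).card)
      = (-1 : ℝ) ^ (f.support.filter (fun c => a < c ∧ c ≤ b)).card := by
    rw [← hcount, ← add_assoc, add_comm, ← add_assoc, pow_add, ← two_mul, pow_mul]
    norm_num
  rw [hpow]
  exact key

end Summit.ValiantsHypothesis.ValiantsHypothesis.Theorems.LacunarySymmetroidMatrixDescartes.Census
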